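import Summits.ValiantsHypothesis.ValiantsHypothesis.Theorems.BarrierLeverChowThinBlockPeel

/-!
# Route BarrierLever — thin-row Chow witnesses (item 20195), part 2/3: the block
# `(1 + y_c - Σ_{b∈B} x_b) * (1 + Σ_{b∈B} x_b + Σ_{a∈Z} x_a)` and its multilinear coefficients

Helper file (`--supports stmt-ValiantsHypothesis-20195`; cell valiant-natproofs, rung V4, 𝒟-side of
door (c); seat val-np-p7 gen 3).  Closes NO item.

The witness of part 3/3 is a product over `c : Fin h` of blocks of two affine forms
`L₁ = 1 + y_c - Σ_{b ∈ B} x_b` and `L₂ = 1 + Σ_{b ∈ B} x_b + Σ_{a ∈ Z} x_a` (`B`, `Z` sets of attached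
`x`-indices, in the application of size `≤ 1` and disjoint).  This file records: the variables of the
block lie in `{x_b : b ∈ B ∪ Z} ∪ {y_c}` (`vars_block`), both forms are affine
(`totalDegree_blockForm₁/₂`), and the four block coefficients used in part 3
(`coeff_block_00 / 0y / x0 / xy`): at `1` and at `y_c` the coefficient is `1`, at `x_a` it is
`[a ∈ Z]`, at `x_a y_c` it is `[a ∈ B] + [a ∈ Z]` — so an `x_b` with `b ∈ B ∖ Z` has the INDICATOR
pattern `(0, 1)` against `(1, y_c)` and an `x_a` with `a ∈ Z ∖ B` the CONSTANT pattern `(1, 1)`.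

WHAT THIS IS NOT: bookkeeping only; nothing on items 20195 / 20172 / 19717, on crux
stmt-ValiantsHypothesis-14610, or on `VP ≠ VNP`.
-/

set_option linter.dupNamespace false

namespace Summit.ValiantsHypothesis.ValiantsHypothesis.Theorems.BarrierLever.ChowThinAffine

open Finset MvPolynomial
open Summit.ValiantsHypothesis.ValiantsHypothesis.Theorems.BarrierLever.ProductStateSums
  (castAdd_ne_natAdd partitionExpo_apply_castAdd partitionExpo_apply_natAdd)
open Summit.ValiantsHypothesis.ValiantsHypothesis.Theorems.BarrierLever.ChowFactor
  (coeff_mul_of_disjoint_vars)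

/-! ## 3. The block `(1 + y_c - Σ_{b∈B} x_b) * (1 + Σ_{b∈B} x_b + Σ_{a∈Z} x_a)` and its coefficients -/

section Block

variable {h : ℕ}

/-- Variables of the first block form. -/
theorem vars_blockForm₁ (c : Fin h) (B Z : Finset (Fin h)) :
    (C 1 + X (Fin.natAdd h c) - ∑ b ∈ B, X (Fin.castAdd h b) : MvPolynomial (Fin (h + h)) ℂ).vars ⊆
      (B ∪ Z).image (Fin.castAdd h) ∪ ({c} : Finset (Fin h)).image (Fin.natAdd h) := by
  classical
  intro v hv
  have h1 := vars_sub_subset (C 1 + X (Fin.natAdd h c) : MvPolynomial (Fin (h + h)) ℂ)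
    (q := ∑ b ∈ B, X (Fin.castAdd h b)) hv
  rw [Finset.mem_union] at h1
  rw [Finset.mem_union, Finset.mem_image, Finset.mem_image]
  rcases h1 with h1 | h1
  · have h2 := vars_add_subset (C 1 : MvPolynomial (Fin (h + h)) ℂ) (X (Fin.natAdd h c)) h1
    rw [vars_C, Finset.empty_union, vars_X, Finset.mem_singleton] at h2
    exact Or.inr ⟨c, Finset.mem_singleton_self c, h2.symm⟩
  · have h2 := vars_sum_subset B (fun b => (X (Fin.castAdd h b) : MvPolynomial (Fin (h + h)) ℂ)) h1
    rw [Finset.mem_biUnion] at h2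
    obtain ⟨b, hb, hvb⟩ := h2
    rw [vars_X, Finset.mem_singleton] at hvb
    exact Or.inl ⟨b, Finset.mem_union_left _ hb, hvb.symm⟩

/-- Variables of the second block form. -/
theorem vars_blockForm₂ (c : Fin h) (B Z : Finset (Fin h)) :
    (C 1 + ∑ b ∈ B, X (Fin.castAdd h b) + ∑ a ∈ Z, X (Fin.castAdd h a) :
        MvPolynomial (Fin (h + h)) ℂ).vars ⊆
      (B ∪ Z).image (Fin.castAdd h) ∪ ({c} : Finset (Fin h)).image (Fin.natAdd h) := by
  classical
  intro v hv
  rw [Finset.mem_union, Finset.mem_image]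
  left
  have h1 := vars_add_subset (C 1 + ∑ b ∈ B, X (Fin.castAdd h b) : MvPolynomial (Fin (h + h)) ℂ)
    (∑ a ∈ Z, X (Fin.castAdd h a)) hv
  rw [Finset.mem_union] at h1
  rcases h1 with h1 | h1
  · have h2 := vars_add_subset (C 1 : MvPolynomial (Fin (h + h)) ℂ) (∑ b ∈ B, X (Fin.castAdd h b)) h1
    rw [vars_C, Finset.empty_union] at h2
    have h3 := vars_sum_subset B (fun b => (X (Fin.castAdd h b) : MvPolynomial (Fin (h + h)) ℂ)) h2
    rw [Finset.mem_biUnion] at h3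
    obtain ⟨b, hb, hvb⟩ := h3
    rw [vars_X, Finset.mem_singleton] at hvb
    exact ⟨b, Finset.mem_union_left _ hb, hvb.symm⟩
  · have h3 := vars_sum_subset Z (fun a => (X (Fin.castAdd h a) : MvPolynomial (Fin (h + h)) ℂ)) h1
    rw [Finset.mem_biUnion] at h3
    obtain ⟨a, ha, hva⟩ := h3
    rw [vars_X, Finset.mem_singleton] at hva
    exact ⟨a, Finset.mem_union_right _ ha, hva.symm⟩

/-- Variables of the block. -/
theorem vars_block (c : Fin h) (B Z : Finset (Fin h)) :
    ((C 1 + X (Fin.natAdd h c) - ∑ b ∈ B, X (Fin.castAdd h b)) *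
        (C 1 + ∑ b ∈ B, X (Fin.castAdd h b) + ∑ a ∈ Z, X (Fin.castAdd h a)) :
        MvPolynomial (Fin (h + h)) ℂ).vars ⊆
      (B ∪ Z).image (Fin.castAdd h) ∪ ({c} : Finset (Fin h)).image (Fin.natAdd h) := by
  classical
  intro v hv
  have := vars_mul _ _ hv
  rw [Finset.mem_union] at this
  rcases this with h1 | h2
  · exact vars_blockForm₁ c B Z h1
  · exact vars_blockForm₂ c B Z h2

/-- The first block form is affine. -/
theorem totalDegree_blockForm₁ (c : Fin h) (B : Finset (Fin h)) :
    (C 1 + X (Fin.natAdd h c) - ∑ b ∈ B, X (Fin.castAdd h b) : MvPolynomial (Fin (h + h)) ℂ).totalDegree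
      ≤ 1 := by
  classical
  refine (totalDegree_sub _ _).trans (max_le ((totalDegree_add _ _).trans (max_le ?_ ?_)) ?_)
  · rw [totalDegree_C]; exact Nat.zero_le _
  · exact (totalDegree_X _).le
  · refine (totalDegree_finsetSum _ _).trans (Finset.sup_le fun b _ => ?_)
    exact (totalDegree_X _).le

/-- The second block form is affine. -/
theorem totalDegree_blockForm₂ (B Z : Finset (Fin h)) :
    (C 1 + ∑ b ∈ B, X (Fin.castAdd h b) + ∑ a ∈ Z, X (Fin.castAdd h a) :
        MvPolynomial (Fin (h + h)) ℂ).totalDegree ≤ 1 := by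
  classical
  refine (totalDegree_add _ _).trans (max_le ((totalDegree_add _ _).trans (max_le ?_ ?_)) ?_)
  · rw [totalDegree_C]; exact Nat.zero_le _
  · refine (totalDegree_finsetSum _ _).trans (Finset.sup_le fun b _ => ?_)
    exact (totalDegree_X _).le
  · refine (totalDegree_finsetSum _ _).trans (Finset.sup_le fun b _ => ?_)
    exact (totalDegree_X _).le

/-- Coefficients of the second (x-only) block form. -/
theorem coeff_blockForm₂ (B Z : Finset (Fin h)) (m : Fin (h + h) →₀ ℕ) :
    coeff m (C 1 + ∑ b ∈ B, X (Fin.castAdd h b) + ∑ a ∈ Z, X (Fin.castAdd h a) :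
        MvPolynomial (Fin (h + h)) ℂ) =
      (if (0 : Fin (h + h) →₀ ℕ) = m then 1 else 0) +
        (∑ b ∈ B, if Finsupp.single (Fin.castAdd h b) 1 = m then (1 : ℂ) else 0) +
        ∑ a ∈ Z, if Finsupp.single (Fin.castAdd h a) 1 = m then (1 : ℂ) else 0 := by
  classical
  rw [coeff_add, coeff_add, coeff_C, coeff_sum, coeff_sum]
  simp only [coeff_X]

/-- The exponent of `x_a` is nonzero. -/
theorem single_castAdd_ne_zero (a : Fin h) :
    (Finsupp.single (Fin.castAdd h a) 1 : Fin (h + h) →₀ ℕ) ≠ 0 :=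
  Finsupp.single_ne_zero.mpr one_ne_zero

/-- The exponent of `y_c` is nonzero. -/
theorem single_natAdd_ne_zero (c : Fin h) :
    (Finsupp.single (Fin.natAdd h c) 1 : Fin (h + h) →₀ ℕ) ≠ 0 :=
  Finsupp.single_ne_zero.mpr one_ne_zero

/-- Exponents of `x_b` and `x_a` agree iff `b = a`. -/
theorem single_castAdd_eq_iff (a b : Fin h) :
    (Finsupp.single (Fin.castAdd h b) 1 : Fin (h + h) →₀ ℕ) = Finsupp.single (Fin.castAdd h a) 1 ↔
      b = a := by
  rw [Finsupp.single_left_inj one_ne_zero]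
  exact ⟨fun e => Fin.castAdd_injective _ _ e, fun e => by rw [e]⟩

/-- Exponents of `x_b` and `y_c` differ. -/
theorem single_castAdd_ne_single_natAdd (b c : Fin h) :
    (Finsupp.single (Fin.castAdd h b) 1 : Fin (h + h) →₀ ℕ) ≠ Finsupp.single (Fin.natAdd h c) 1 := by
  rw [Ne, Finsupp.single_left_inj one_ne_zero]
  exact castAdd_ne_natAdd b c

/-- The exponent of `x_b` is not the exponent of `x_a y_c`. -/
theorem single_castAdd_ne_pair (b a c : Fin h) :
    (Finsupp.single (Fin.castAdd h b) 1 : Fin (h + h) →₀ ℕ) ≠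
      Finsupp.single (Fin.castAdd h a) 1 + Finsupp.single (Fin.natAdd h c) 1 := by
  intro e
  have := DFunLike.congr_fun e (Fin.natAdd h c)
  rw [Finsupp.add_apply, Finsupp.single_apply, Finsupp.single_apply, Finsupp.single_apply,
    if_neg (castAdd_ne_natAdd b c), if_neg (castAdd_ne_natAdd a c), if_pos rfl] at this
  exact absurd this (by norm_num)

/-- The zero exponent is not the exponent of `x_a y_c`. -/
theorem zero_ne_pair (a c : Fin h) :
    (0 : Fin (h + h) →₀ ℕ) ≠ Finsupp.single (Fin.castAdd h a) 1 + Finsupp.single (Fin.natAdd h c) 1 := by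
  intro e
  have := DFunLike.congr_fun e (Fin.natAdd h c)
  rw [Finsupp.zero_apply, Finsupp.add_apply, Finsupp.single_apply, Finsupp.single_apply,
    if_neg (castAdd_ne_natAdd a c), if_pos rfl] at this
  exact absurd this (by norm_num)

/-- `coeff 0` of the second block form. -/
theorem coeff_zero_blockForm₂ (B Z : Finset (Fin h)) :
    coeff 0 (C 1 + ∑ b ∈ B, X (Fin.castAdd h b) + ∑ a ∈ Z, X (Fin.castAdd h a) :
        MvPolynomial (Fin (h + h)) ℂ) = 1 := by
  classical
  rw [coeff_blockForm₂, if_pos rfl]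
  rw [Finset.sum_eq_zero fun b _ => if_neg (single_castAdd_ne_zero b),
    Finset.sum_eq_zero fun a _ => if_neg (single_castAdd_ne_zero a)]
  ring

/-- `coeff x_a` of the second block form. -/
theorem coeff_x_blockForm₂ (B Z : Finset (Fin h)) (a : Fin h) :
    coeff (Finsupp.single (Fin.castAdd h a) 1)
        (C 1 + ∑ b ∈ B, X (Fin.castAdd h b) + ∑ a ∈ Z, X (Fin.castAdd h a) :
          MvPolynomial (Fin (h + h)) ℂ) =
      (if a ∈ B then 1 else 0) + (if a ∈ Z then 1 else 0) := by
  classical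
  rw [coeff_blockForm₂, if_neg (single_castAdd_ne_zero a).symm, zero_add]
  simp only [single_castAdd_eq_iff]
  rw [Finset.sum_ite_eq' B a, Finset.sum_ite_eq' Z a]

/-- `coeff y_c` of the second block form. -/
theorem coeff_y_blockForm₂ (B Z : Finset (Fin h)) (c : Fin h) :
    coeff (Finsupp.single (Fin.natAdd h c) 1)
        (C 1 + ∑ b ∈ B, X (Fin.castAdd h b) + ∑ a ∈ Z, X (Fin.castAdd h a) :
          MvPolynomial (Fin (h + h)) ℂ) = 0 := by
  classical
  rw [coeff_blockForm₂, if_neg (single_natAdd_ne_zero c).symm, zero_add]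
  rw [Finset.sum_eq_zero fun b _ => if_neg (single_castAdd_ne_single_natAdd b c),
    Finset.sum_eq_zero fun a _ => if_neg (single_castAdd_ne_single_natAdd a c), add_zero]

/-- `coeff (x_a y_c)` of the second block form. -/
theorem coeff_xy_blockForm₂ (B Z : Finset (Fin h)) (a c : Fin h) :
    coeff (Finsupp.single (Fin.castAdd h a) 1 + Finsupp.single (Fin.natAdd h c) 1)
        (C 1 + ∑ b ∈ B, X (Fin.castAdd h b) + ∑ a ∈ Z, X (Fin.castAdd h a) :
          MvPolynomial (Fin (h + h)) ℂ) = 0 := by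
  classical
  rw [coeff_blockForm₂, if_neg (zero_ne_pair a c), zero_add]
  rw [Finset.sum_eq_zero fun b _ => if_neg (single_castAdd_ne_pair b a c),
    Finset.sum_eq_zero fun b _ => if_neg (single_castAdd_ne_pair b a c), add_zero]

/-- Coefficients of the block via the decomposition `L₁ * L₂ = L₂ - (Σ x_b) * L₂ + y_c * L₂`. -/
theorem coeff_block_eq (c : Fin h) (B Z : Finset (Fin h)) (m : Fin (h + h) →₀ ℕ) :
    coeff m ((C 1 + X (Fin.natAdd h c) - ∑ b ∈ B, X (Fin.castAdd h b)) *
        (C 1 + ∑ b ∈ B, X (Fin.castAdd h b) + ∑ a ∈ Z, X (Fin.castAdd h a)) :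
        MvPolynomial (Fin (h + h)) ℂ) =
      coeff m (C 1 + ∑ b ∈ B, X (Fin.castAdd h b) + ∑ a ∈ Z, X (Fin.castAdd h a) :
          MvPolynomial (Fin (h + h)) ℂ) -
        (∑ b ∈ B, if Fin.castAdd h b ∈ m.support then
            coeff (m - Finsupp.single (Fin.castAdd h b) 1)
              (C 1 + ∑ b ∈ B, X (Fin.castAdd h b) + ∑ a ∈ Z, X (Fin.castAdd h a) :
                MvPolynomial (Fin (h + h)) ℂ) else 0) +
        (if Fin.natAdd h c ∈ m.support then
            coeff (m - Finsupp.single (Fin.natAdd h c) 1)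
              (C 1 + ∑ b ∈ B, X (Fin.castAdd h b) + ∑ a ∈ Z, X (Fin.castAdd h a) :
                MvPolynomial (Fin (h + h)) ℂ) else 0) := by
  classical
  set L₂ : MvPolynomial (Fin (h + h)) ℂ :=
    C 1 + ∑ b ∈ B, X (Fin.castAdd h b) + ∑ a ∈ Z, X (Fin.castAdd h a) with hL₂
  have key : (C 1 + X (Fin.natAdd h c) - ∑ b ∈ B, X (Fin.castAdd h b)) * L₂ =
      C 1 * L₂ - ∑ b ∈ B, X (Fin.castAdd h b) * L₂ + X (Fin.natAdd h c) * L₂ := by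
    rw [← Finset.sum_mul]; ring
  rw [key, coeff_add, coeff_sub, coeff_C_mul, one_mul, coeff_sum, coeff_X_mul']
  congr 2
  exact Finset.sum_congr rfl fun b _ => coeff_X_mul' _ _ _

/-- Block coefficient at `(∅, ∅)`. -/
theorem coeff_block_00 (c : Fin h) (B Z : Finset (Fin h)) :
    coeff (∑ a' ∈ (∅ : Finset (Fin h)), Finsupp.single (Fin.castAdd h a') 1 +
        ∑ c' ∈ (∅ : Finset (Fin h)), Finsupp.single (Fin.natAdd h c') 1)
      ((C 1 + X (Fin.natAdd h c) - ∑ b ∈ B, X (Fin.castAdd h b)) *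
        (C 1 + ∑ b ∈ B, X (Fin.castAdd h b) + ∑ a ∈ Z, X (Fin.castAdd h a)) :
        MvPolynomial (Fin (h + h)) ℂ) = 1 := by
  classical
  rw [Finset.sum_empty, Finset.sum_empty, add_zero, coeff_block_eq, coeff_zero_blockForm₂]
  simp [Finsupp.support_zero]

/-- Block coefficient at `(∅, {c})`. -/
theorem coeff_block_0y (c : Fin h) (B Z : Finset (Fin h)) :
    coeff (∑ a' ∈ (∅ : Finset (Fin h)), Finsupp.single (Fin.castAdd h a') 1 +
        ∑ c' ∈ ({c} : Finset (Fin h)), Finsupp.single (Fin.natAdd h c') 1)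
      ((C 1 + X (Fin.natAdd h c) - ∑ b ∈ B, X (Fin.castAdd h b)) *
        (C 1 + ∑ b ∈ B, X (Fin.castAdd h b) + ∑ a ∈ Z, X (Fin.castAdd h a)) :
        MvPolynomial (Fin (h + h)) ℂ) = 1 := by
  classical
  rw [Finset.sum_empty, Finset.sum_singleton, zero_add, coeff_block_eq, coeff_y_blockForm₂]
  have hsupp : (Finsupp.single (Fin.natAdd h c) 1 : Fin (h + h) →₀ ℕ).support = {Fin.natAdd h c} :=
    Finsupp.support_single _ one_ne_zero
  rw [hsupp, if_pos (Finset.mem_singleton_self _), tsub_self, coeff_zero_blockForm₂]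
  rw [Finset.sum_eq_zero]
  · ring
  · intro b _
    rw [if_neg]
    rw [Finset.mem_singleton]
    exact castAdd_ne_natAdd b c

/-- Block coefficient at `({a}, ∅)`. -/
theorem coeff_block_x0 (c : Fin h) (B Z : Finset (Fin h)) (a : Fin h) :
    coeff (∑ a' ∈ ({a} : Finset (Fin h)), Finsupp.single (Fin.castAdd h a') 1 +
        ∑ c' ∈ (∅ : Finset (Fin h)), Finsupp.single (Fin.natAdd h c') 1)
      ((C 1 + X (Fin.natAdd h c) - ∑ b ∈ B, X (Fin.castAdd h b)) *
        (C 1 + ∑ b ∈ B, X (Fin.castAdd h b) + ∑ a ∈ Z, X (Fin.castAdd h a)) :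
        MvPolynomial (Fin (h + h)) ℂ) = if a ∈ Z then 1 else 0 := by
  classical
  rw [Finset.sum_singleton, Finset.sum_empty, add_zero, coeff_block_eq, coeff_x_blockForm₂]
  have hsupp : (Finsupp.single (Fin.castAdd h a) 1 : Fin (h + h) →₀ ℕ).support = {Fin.castAdd h a} :=
    Finsupp.support_single _ one_ne_zero
  rw [hsupp]
  have hy : Fin.natAdd h c ∉ ({Fin.castAdd h a} : Finset (Fin (h + h))) := by
    rw [Finset.mem_singleton]; exact (castAdd_ne_natAdd a c).symm
  rw [if_neg hy, add_zero]
  have hsum : (∑ b ∈ B, if Fin.castAdd h b ∈ ({Fin.castAdd h a} : Finset (Fin (h + h))) then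
      coeff (Finsupp.single (Fin.castAdd h a) 1 - Finsupp.single (Fin.castAdd h b) 1)
        (C 1 + ∑ b ∈ B, X (Fin.castAdd h b) + ∑ a ∈ Z, X (Fin.castAdd h a) :
          MvPolynomial (Fin (h + h)) ℂ) else 0) = if a ∈ B then 1 else 0 := by
    have : ∀ b ∈ B, (if Fin.castAdd h b ∈ ({Fin.castAdd h a} : Finset (Fin (h + h))) then
        coeff (Finsupp.single (Fin.castAdd h a) 1 - Finsupp.single (Fin.castAdd h b) 1)
          (C 1 + ∑ b ∈ B, X (Fin.castAdd h b) + ∑ a ∈ Z, X (Fin.castAdd h a) :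
            MvPolynomial (Fin (h + h)) ℂ) else 0) = if a = b then 1 else 0 := by
      intro b _
      by_cases hab : a = b
      · subst hab
        rw [if_pos (Finset.mem_singleton_self _), tsub_self, coeff_zero_blockForm₂, if_pos rfl]
      · rw [if_neg, if_neg hab]
        rw [Finset.mem_singleton]
        exact fun e => hab (Fin.castAdd_injective _ _ e).symm
    rw [Finset.sum_congr rfl this, Finset.sum_ite_eq]
  rw [hsum]
  ring

/-- Block coefficient at `({a}, {c})`. -/
theorem coeff_block_xy (c : Fin h) (B Z : Finset (Fin h)) (a : Fin h) :
    coeff (∑ a' ∈ ({a} : Finset (Fin h)), Finsupp.single (Fin.castAdd h a') 1 +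
        ∑ c' ∈ ({c} : Finset (Fin h)), Finsupp.single (Fin.natAdd h c') 1)
      ((C 1 + X (Fin.natAdd h c) - ∑ b ∈ B, X (Fin.castAdd h b)) *
        (C 1 + ∑ b ∈ B, X (Fin.castAdd h b) + ∑ a ∈ Z, X (Fin.castAdd h a)) :
        MvPolynomial (Fin (h + h)) ℂ) = (if a ∈ B then 1 else 0) + (if a ∈ Z then 1 else 0) := by
  classical
  rw [Finset.sum_singleton, Finset.sum_singleton, coeff_block_eq, coeff_xy_blockForm₂]
  have hval : ∀ v, (Finsupp.single (Fin.castAdd h a) 1 + Finsupp.single (Fin.natAdd h c) 1 :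
      Fin (h + h) →₀ ℕ) v =
      (if Fin.castAdd h a = v then 1 else 0) + (if Fin.natAdd h c = v then 1 else 0) := by
    intro v
    rw [Finsupp.add_apply, Finsupp.single_apply, Finsupp.single_apply]
  have hmem_y : Fin.natAdd h c ∈ (Finsupp.single (Fin.castAdd h a) 1 +
      Finsupp.single (Fin.natAdd h c) 1 : Fin (h + h) →₀ ℕ).support := by
    rw [Finsupp.mem_support_iff, hval, if_neg (castAdd_ne_natAdd a c), if_pos rfl]
    exact one_ne_zero
  rw [if_pos hmem_y, add_tsub_cancel_right, coeff_x_blockForm₂]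
  have hsum : (∑ b ∈ B, if Fin.castAdd h b ∈ (Finsupp.single (Fin.castAdd h a) 1 +
      Finsupp.single (Fin.natAdd h c) 1 : Fin (h + h) →₀ ℕ).support then
      coeff (Finsupp.single (Fin.castAdd h a) 1 + Finsupp.single (Fin.natAdd h c) 1 -
          Finsupp.single (Fin.castAdd h b) 1)
        (C 1 + ∑ b ∈ B, X (Fin.castAdd h b) + ∑ a ∈ Z, X (Fin.castAdd h a) :
          MvPolynomial (Fin (h + h)) ℂ) else 0) = 0 := by
    apply Finset.sum_eq_zero
    intro b _
    by_cases hab : b = a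
    · rw [hab]
      have hmem_a : Fin.castAdd h a ∈ (Finsupp.single (Fin.castAdd h a) 1 +
          Finsupp.single (Fin.natAdd h c) 1 : Fin (h + h) →₀ ℕ).support := by
        rw [Finsupp.mem_support_iff, hval, if_pos rfl, if_neg (castAdd_ne_natAdd a c).symm]
        exact one_ne_zero
      rw [if_pos hmem_a, add_tsub_cancel_left, coeff_y_blockForm₂]
    · have hnot : Fin.castAdd h b ∉ (Finsupp.single (Fin.castAdd h a) 1 +
          Finsupp.single (Fin.natAdd h c) 1 : Fin (h + h) →₀ ℕ).support := by
        rw [Finsupp.mem_support_iff, not_not, hval,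
          if_neg (fun e => hab (Fin.castAdd_injective _ _ e).symm), if_neg (castAdd_ne_natAdd b c).symm,
          add_zero]
      rw [if_neg hnot]
  rw [hsum]
  ring

end Block

end Summit.ValiantsHypothesis.ValiantsHypothesis.Theorems.BarrierLever.ChowThinAffine
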